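import Mathlib

/-!
# I3-LENS6 round 3 (abc-iut-idea-6 g3) — kernel face of negative n11
«SECTION-COUNT licence over a label-split pilot object = DEGREE licence = reading (R)».

Model: the Θ-side pilot object split by labels `j : Fin n` into Hermitian lines of (normalised) Arakelov
degree `e j` RELATIVE to the q-side line (so the q-side is the constant family `0`), both twisted by an
ample parameter `t ≥ 0`; the idealised global-section count of a line of degree `d` is `max 0 d`
(Riemann–Roch–Minkowski up to a rank-size genus bill, [corpus:book:peyre2021-arakelov-geometry-diophantine-applications p.99]).
`countLicence e` := the count inequality holds under EVERY twist; `degreeLicence e` := total degree ≥ 0.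
The two are EQUIVALENT (`countLicence_iff_degreeLicence`): a count functional (¬H1, adelic by nature) adds no
cross-label / cross-place financing beyond the realified degree comparison (R) — census O-95's level.
No side taken on [IUTchIII] Cor 3.12 (D-0045); a finite model, not IUT; typed ≠ proved for the crux; NO abc claim.
-/

set_option linter.dupNamespace false

namespace Summit.ABC.ABC.Cruxes.ThetaPartII.L6Round3

open Finset

/-- count licence: for every ample twist `t ≥ 0`, the Θ-side section count dominates the q-side one. -/
def countLicence {n : ℕ} (e : Fin n → ℝ) : Prop :=
  ∀ t : ℝ, 0 ≤ t → (n : ℝ) * t ≤ ∑ j, max 0 (e j + t)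

/-- degree licence: total relative degree is non-negative (the realified reading (R)). -/
def degreeLicence {n : ℕ} (e : Fin n → ℝ) : Prop := 0 ≤ ∑ j, e j

theorem degreeLicence_imp_countLicence {n : ℕ} (e : Fin n → ℝ) (h : degreeLicence e) : countLicence e := by
  intro t ht
  calc (n : ℝ) * t = ∑ _j : Fin n, t := by simp
    _ ≤ (∑ j, e j) + ∑ _j : Fin n, t := by unfold degreeLicence at h; linarith
    _ = ∑ j, (e j + t) := by rw [← Finset.sum_add_distrib]
    _ ≤ ∑ j, max 0 (e j + t) := Finset.sum_le_sum fun j _ => le_max_right _ _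

theorem countLicence_imp_degreeLicence {n : ℕ} (e : Fin n → ℝ) (h : countLicence e) : degreeLicence e := by
  unfold degreeLicence
  -- twist by t := Σ |e j|, which makes every summand non-negative
  set t : ℝ := ∑ j, |e j| with ht
  have ht0 : 0 ≤ t := Finset.sum_nonneg fun j _ => abs_nonneg _
  have hpos : ∀ j, 0 ≤ e j + t := by
    intro j
    have h1 : |e j| ≤ t := by
      rw [ht]; exact Finset.single_le_sum (f := fun i => |e i|) (fun i _ => abs_nonneg _) (Finset.mem_univ j)
    have h2 : -|e j| ≤ e j := neg_abs_le _
    linarith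
  have key := h t ht0
  have hmax : ∑ j, max 0 (e j + t) = ∑ j, (e j + t) :=
    Finset.sum_congr rfl fun j _ => max_eq_right (hpos j)
  rw [hmax, Finset.sum_add_distrib] at key
  simp at key
  linarith

/-- **n11, kernel face.** Count licence under all twists ⟺ degree licence. -/
theorem countLicence_iff_degreeLicence {n : ℕ} (e : Fin n → ℝ) : countLicence e ↔ degreeLicence e :=
  ⟨countLicence_imp_degreeLicence e, degreeLicence_imp_countLicence e⟩

/-- Sanity instance (print-shaped data, l⋆ = 3 labels with relative degrees −(j²−1)·a + b):
with a = 1, b = 3 the degrees are (3, 0, −5), total −2 < 0: neither licence holds although two of three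
labels are individually licensed — pooling across labels is exactly the degree sum, nothing finer. -/
example : ¬ degreeLicence (![3, 0, -5] : Fin 3 → ℝ) := by
  unfold degreeLicence; simp [Fin.sum_univ_succ]; norm_num

end Summit.ABC.ABC.Cruxes.ThetaPartII.L6Round3
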